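import Literature.NumberTheory.NumberFields.CMFieldQuadraticLayerNoCapitulation
import Literature.NumberTheory.IwasawaTheory.ImaginaryQuadraticTwoTowerRankStabilisation
import Literature.NumberTheory.IwasawaTheory.ClassicalLambdaGeRankOfNoCapitulation
import Literature.NumberTheory.EllipticCurves.ZpExtensionRestrictLayerCompositum
import HarnessLib

/-!
# No capitulation in the cyclotomic `ℤ₂`-tower of an imaginary quadratic field with odd discriminant (modulo «no new roots of unity»), and the LOWER
# half of Ferrero's / Kida's formula: `λ₂(K) = Σ_{ℓ ∣ d_K} 2^{ord₂(ℓ²−1)−3} − 1` EXACTLY (proved; no definition, no named fact)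

Topic `NumberTheory/IwasawaTheory` (namespace = path).  THEOREM-ONLY file, written by the prover seat `bsd-line-att-p3` g31 (cell `bsd-f1-sign2`; `--supports`
stmt-BirchSwinnertonDyer-22298; closes nothing).  Assembles `NumberFields/CMFieldQuadraticLayerNoCapitulation` (abstract: `Cl(M) → Cl(L)` injective for a quadratic
CM layer under (T), (NPI), (ODD), (RAM)), this seat's g30 files (`ImaginaryQuadraticTwoTowerGenusRank*`, `…RankStabilisation`: `rank₂ Cl(K_n) = Σ − 1` for `n ≫ 0`,
`μ₂ = 0`, `λ₂ ≤ Σ − 1`) and `ClassicalLambdaGeRankOfNoCapitulation` (no capitulation ⟹ `λ =` eventual rank).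

SETTING.  `κ` a cyclotomic `ℤ₂`-extension of `ℚ` (layers `ℚ_n ⊆ ℚ̄`), `K` imaginary quadratic with ODD `d_K`, `e = absEmbedding ℚ K`, `X_n = e(K)·ℚ_n ⊆ ℚ̄`
(`≅ (K·ℚ_∞)_n`, tree `ZpExtensionRestrictLayerCompositum`).  §2 discharges (ODD), (RAM) and the CM structure for the pair `X_{n+1} ⊆ X_{n+2}` (Weber: `h(ℚ_m)` odd;
`ℓ ∤ d(ℚ_m)` for odd `ℓ`; the primes of `X_m⁺ ≅ ℚ_m` ramified in `X_m` lie over the prime factors of `d_K`); §3 derives (NPI) from «the roots of unity of `X_m` lie in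
`e(K)`» (HYPOTHESIS (W) — no new roots of unity in the tower; true for `d_K` odd, to be discharged in the sequel) and Hasse–Weber «totally positive units of `ℚ_m`
are squares»; §4 ★ `classGroupExtend_injective_fieldRange_sup_layer`: **(W) ⟹ `Cl(X_{n+1}) → Cl(X_{n+2})` injective**; §5 transports to the layers of
`κ|_K` (explicit compatible isomorphisms along `absClosureEquiv`) and concludes ★ `classicalLambda_add_one_eq_ferreroKidaSum_of_rootsOfUnity`:
**(W) ⟹ `classicalLambda κK + 1 = Σ_{ℓ ∣ d_K} 2^{ord₂(ℓ²−1)−3}` for every cyclotomic `ℤ₂`-extension `κK` of `K`** — the named fact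
`ferreroKida_classicalLambda_two_imaginaryQuadratic` on its `d ≡ 3 (mod 4)` half, modulo (W).

References: [Ferrero1980AJM] §§2–3; [Kida1979Tohoku] Thm. 1; [Washington1997] Thm. 10.3, §13.1, Prop. 13.22–13.28; [Fukuda1994] Thm. 1.
-/

set_option autoImplicit false

noncomputable section

open scoped NumberField nonZeroDivisors
open NumberField NumberField.IsCMField IsDedekindDomain Field IntermediateField Module Ideal

namespace Literature.NumberTheory.IwasawaTheory

open Literature.NumberTheory.EllipticCurves Literature.NumberTheory.EllipticCurves.ZpExtension
  Literature.NumberTheory.GaloisRepresentations Literature.NumberTheory.NumberFields Literature.NumberTheory.NumberFields.CMLayer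

/-! ## §1 Transport of (non-)capitulation along isomorphic pairs -/

section Transport

variable {M L M' L' : Type} [Field M] [NumberField M] [Field L] [NumberField L] [Algebra M L]
  [Field M'] [NumberField M'] [Field L'] [NumberField L'] [Algebra M' L']

/-- **Injectivity of `Cl(M) → Cl(L)` is invariant under isomorphism of pairs**: ring isomorphisms `eM : M' ≃ M`, `eL : L' ≃ L` compatible with the structure
maps transport «every capitulating ideal is principal» (an ideal of `𝓞 M` and its transform in `𝓞 M'` are principal together). [cite: NeukirchANT1999, Ch. III §1 Prop. (1.6)] -/
theorem classGroupExtend_injective_of_ringEquiv (eM : M' ≃+* M) (eL : L' ≃+* L)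
    (hcomp : ∀ x : M', eL (algebraMap M' L' x) = algebraMap M L (eM x)) (h : Function.Injective (classGroupExtend M' L')) :
    Function.Injective (classGroupExtend M L) := by
  classical
  rw [injective_iff_map_eq_one] at h ⊢
  intro c hc
  obtain ⟨𝔞, h𝔞, α, rfl, hα, -⟩ := exists_rep_of_classGroupExtend_eq_one M L hc
  -- transport `𝔞` to `𝓞 M'`
  set fM : 𝓞 M ≃+* 𝓞 M' := RingOfIntegers.mapRingEquiv eM.symm with hfM
  set fL : 𝓞 L ≃+* 𝓞 L' := RingOfIntegers.mapRingEquiv eL.symm with hfL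
  have hsq : (algebraMap (𝓞 M') (𝓞 L')).comp (fM : 𝓞 M →+* 𝓞 M') = (fL : 𝓞 L →+* 𝓞 L').comp (algebraMap (𝓞 M) (𝓞 L)) := by
    ext x
    change algebraMap M' L' (eM.symm (x : M)) = eL.symm (algebraMap M L (x : M))
    rw [RingEquiv.eq_symm_apply, hcomp, RingEquiv.apply_symm_apply]
  set 𝔞' : Ideal (𝓞 M') := 𝔞.map (fM : 𝓞 M →+* 𝓞 M') with h𝔞'
  have h𝔞'0 : 𝔞' ≠ ⊥ := by
    have hinj : Function.Injective ((fM : 𝓞 M →+* 𝓞 M')) := fM.injective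
    rw [h𝔞', Ne, Ideal.map_eq_bot_iff_of_injective hinj]; exact h𝔞
  have hprin' : (𝔞'.map (algebraMap (𝓞 M') (𝓞 L'))).IsPrincipal := by
    rw [h𝔞', Ideal.map_map, hsq, ← Ideal.map_map, hα, Ideal.map_span, Set.image_singleton]
    exact ⟨⟨fL α, rfl⟩⟩
  have h1 : classGroupExtend M' L' (ClassGroup.mk0 ⟨𝔞', mem_nonZeroDivisors_of_ne_zero h𝔞'0⟩) = 1 := by
    rw [classGroupExtend_mk0, ClassGroup.mk0_eq_one_iff]; exact hprin'
  have h2 := h _ h1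
  rw [ClassGroup.mk0_eq_one_iff] at h2 ⊢
  obtain ⟨a', ha'⟩ := h2
  have : 𝔞 = Ideal.span {fM.symm a'} := by
    have := congrArg (Ideal.map (fM.symm : 𝓞 M' →+* 𝓞 M)) ha'
    rw [h𝔞', Ideal.map_of_equiv] at this
    rw [this]
    change Ideal.map (fM.symm : 𝓞 M' →+* 𝓞 M) (Ideal.span {a'}) = _
    rw [Ideal.map_span, Set.image_singleton]; rfl
  rw [this]; exact ⟨⟨fM.symm a', rfl⟩⟩

end Transport

/-! ## §2 The CM pair `X_{n+1} ⊆ X_{n+2}`, `X_m = e(K)·ℚ_m`: structure, (ODD), (RAM) -/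

section Setup

variable {κ : ZpExtension ℚ 2} (hκ : κ.IsCyclotomic) (K : Type) [Field K] [NumberField K] (hK : IsImaginaryQuadratic K)
  (j : K →ₐ[ℚ] AlgebraicClosure ℚ)

include hκ hK in
/-- **`X_m = j(K)·ℚ_m` is a CM field with `[X_m : ℚ] = 2^m·2`, `[X_m : ℚ_m] = 2`, `h(X_m⁺)` odd, every totally positive unit of `X_m⁺` a square, `ℓ ∤ d(X_m⁺)` for odd `ℓ`,
and `X_m = X_m⁺(j(K))`** (`X_m⁺ ≅ ℚ_m`; Weber–Hasse on `ℚ_m`).  [cite: Washington1997, §13.1 and Cor. 10.5] [cite: Okazaki2000, §3 Lemma 15 and Lemma 17] -/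
theorem isCMField_fieldRange_sup_layer (m : ℕ) :
    haveI : NumberField ↥(j.fieldRange ⊔ κ.layer m) := numberField_fieldRange_sup_layer κ K j m
    IsCMField ↥(j.fieldRange ⊔ κ.layer m) ∧ Module.finrank ℚ ↥(j.fieldRange ⊔ κ.layer m) = 2 ^ m * 2 ∧
      (∀ [IsCMField ↥(j.fieldRange ⊔ κ.layer m)],
        Odd (classNumber ↥(maximalRealSubfield ↥(j.fieldRange ⊔ κ.layer m))) ∧
        (∀ u : (𝓞 ↥(maximalRealSubfield ↥(j.fieldRange ⊔ κ.layer m)))ˣ,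
          (∀ σ : ↥(maximalRealSubfield ↥(j.fieldRange ⊔ κ.layer m)) →+* ℝ,
            0 < σ ((u : 𝓞 ↥(maximalRealSubfield ↥(j.fieldRange ⊔ κ.layer m))) : ↥(maximalRealSubfield ↥(j.fieldRange ⊔ κ.layer m)))) → IsSquare u) ∧
        (∀ ℓ : ℕ, ℓ.Prime → ℓ ≠ 2 → ¬ (ℓ : ℤ) ∣ NumberField.discr ↥(maximalRealSubfield ↥(j.fieldRange ⊔ κ.layer m))) ∧
        IntermediateField.adjoin ↥(maximalRealSubfield ↥(j.fieldRange ⊔ κ.layer m))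
          (Set.range ((j : K →+* AlgebraicClosure ℚ).codRestrict (j.fieldRange ⊔ κ.layer m)
            fun x => (le_sup_left : j.fieldRange ≤ j.fieldRange ⊔ κ.layer m) (j.mem_fieldRange.mpr ⟨x, rfl⟩))) = ⊤) := by
  classical
  set n := m
  haveI : FiniteDimensional ℚ ↥(κ.layer n) := κ.finiteDimensional_layer_holds n
  haveI : NumberField ↥(κ.layer n) := NumberField.of_module_finite ℚ _
  haveI : IsTotallyReal ↥(κ.layer n) := isTotallyReal_layer_rat κ n
  haveI : NumberField ↥(j.fieldRange ⊔ κ.layer n) := numberField_fieldRange_sup_layer κ K j n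
  have hle : κ.layer n ≤ j.fieldRange ⊔ κ.layer n := le_sup_right
  letI algL : Algebra ↥(κ.layer n) ↥(j.fieldRange ⊔ κ.layer n) := (IntermediateField.inclusion hle).toRingHom.toAlgebra
  haveI : IsScalarTower ℚ ↥(κ.layer n) ↥(j.fieldRange ⊔ κ.layer n) := IsScalarTower.of_algebraMap_eq fun _ => rfl
  let eK : K →+* ↥(j.fieldRange ⊔ κ.layer n) :=
    (j : K →+* AlgebraicClosure ℚ).codRestrict (j.fieldRange ⊔ κ.layer n) fun x =>
      (le_sup_left : j.fieldRange ≤ j.fieldRange ⊔ κ.layer n) (j.mem_fieldRange.mpr ⟨x, rfl⟩)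
  letI algK : Algebra K ↥(j.fieldRange ⊔ κ.layer n) := eK.toAlgebra
  haveI : IsTotallyComplex K := hK.2
  haveI : IsTotallyComplex ↥(j.fieldRange ⊔ κ.layer n) := isTotallyComplex_of_algebra (F := K) _
  have hsurj := surjective_comp_absGaloisRestrict_imaginaryQuadratic_two hκ K hK
  obtain ⟨eF⟩ := nonempty_algEquiv_layer_restrict_fieldRange_sup_layer κ K hsurj j n
  have hdegF : Module.finrank ℚ ↥(j.fieldRange ⊔ κ.layer n) = 2 ^ n * 2 := by
    have h1 : Module.finrank ℚ ↥((κ.restrict K hsurj).layer n) = Module.finrank ℚ ↥(j.fieldRange ⊔ κ.layer n) :=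
      eF.toLinearEquiv.finrank_eq
    have h2 := finrank_layer_restrict κ K hsurj n
    rw [hK.1] at h2
    omega
  haveI : Module.Free ↥(κ.layer n) ↥(j.fieldRange ⊔ κ.layer n) := Module.Free.of_divisionRing _ _
  haveI : Algebra.IsQuadraticExtension ↥(κ.layer n) ↥(j.fieldRange ⊔ κ.layer n) := by
    refine { finrank_eq_two' := ?_ }
    have h1 := Module.finrank_mul_finrank ℚ ↥(κ.layer n) ↥(j.fieldRange ⊔ κ.layer n)
    rw [κ.finrank_layer_holds n, hdegF] at h1
    exact Nat.eq_of_mul_eq_mul_left (pow_pos two_pos n) h1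
  haveI hCM : IsCMField ↥(j.fieldRange ⊔ κ.layer n) := IsCMField.ofCMExtension ↥(κ.layer n) _
  refine ⟨hCM, hdegF, fun {_} => ?_⟩
  let e := CMExtension.equivMaximalRealSubfield ↥(κ.layer n) ↥(j.fieldRange ⊔ κ.layer n)
  obtain ⟨hoddL, hsqL⟩ := odd_classNumber_and_forall_isSquare_layer_two hκ n
  refine ⟨odd_classNumber_of_ringEquiv e hoddL, forall_isSquare_of_totallyPositive_of_ringEquiv e hsqL, ?_, ?_⟩
  · intro ℓ hℓ hℓ2
    have eQ : ↥(κ.layer n) ≃ₐ[ℚ] ↥(maximalRealSubfield ↥(j.fieldRange ⊔ κ.layer n)) := AlgEquiv.ofRingEquiv (f := e) fun q => by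
      rw [eq_ratCast (algebraMap ℚ ↥(κ.layer n)) q, map_ratCast, eq_ratCast (algebraMap ℚ _) q]
    rw [← NumberField.discr_eq_discr_of_algEquiv ↥(κ.layer n) eQ]
    exact not_dvd_discr_layer hκ n hℓ hℓ2
  · -- `X_m` is generated over `X_m⁺` by the image of `K` (otherwise `K` would embed in the totally real `X_m⁺`)
    set Fp := maximalRealSubfield ↥(j.fieldRange ⊔ κ.layer n) with hFp
    set E := IntermediateField.adjoin (↥Fp) (Set.range (algebraMap K ↥(j.fieldRange ⊔ κ.layer n))) with hE
    have h2 : (Module.finrank (↥Fp) ↥(j.fieldRange ⊔ κ.layer n)).Prime := by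
      rw [(IsCMField.isQuadraticExtension ↥(j.fieldRange ⊔ κ.layer n)).finrank_eq_two]; exact Nat.prime_two
    haveI := IntermediateField.isSimpleOrder_of_finrank_prime (↥Fp) ↥(j.fieldRange ⊔ κ.layer n) h2
    rcases eq_bot_or_eq_top E with h | h
    · exfalso
      have hmemFp : ∀ x : K, algebraMap K ↥(j.fieldRange ⊔ κ.layer n) x ∈ Fp := fun x => by
        obtain ⟨y, hy⟩ := IntermediateField.mem_bot.mp (h ▸ IntermediateField.subset_adjoin _ _ ⟨x, rfl⟩ :
          algebraMap K ↥(j.fieldRange ⊔ κ.layer n) x ∈ (⊥ : IntermediateField ↥Fp ↥(j.fieldRange ⊔ κ.layer n)))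
        exact hy ▸ y.2
      letI : Algebra K ↥Fp := ((algebraMap K ↥(j.fieldRange ⊔ κ.layer n)).codRestrict Fp hmemFp).toAlgebra
      haveI : IsScalarTower ℚ K ↥Fp := IsScalarTower.of_algebraMap_eq' (Subsingleton.elim _ _)
      haveI : Algebra.IsAlgebraic K ↥Fp :=
        Algebra.IsAlgebraic.extendScalars (R := ℚ) (S := K) (A := ↥Fp) (algebraMap ℚ K).injective
      haveI : IsTotallyReal K := IsTotallyReal.of_algebra K ↥Fp
      obtain ⟨w⟩ := (inferInstance : Nonempty (InfinitePlace K))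
      exact (InfinitePlace.not_isReal_iff_isComplex.mpr (IsTotallyComplex.isComplex w)) (IsTotallyReal.isReal w)
    · exact h

end Setup

/-! ## §3 (RAM) for the pair `X_{n+1} ⊆ X_{n+2}` -/

section Ram

variable {κ : ZpExtension ℚ 2} (hκ : κ.IsCyclotomic) (K : Type) [Field K] [NumberField K] (hK : IsImaginaryQuadratic K)
  (j : K →ₐ[ℚ] AlgebraicClosure ℚ)

omit hκ hK in
/-- `e ≤ 2` in a CM quadratic extension `L/L⁺` (fundamental identity `g·e·f = 2`). [cite: NeukirchANT1999, Ch. I §9 Prop. (9.6)] -/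
theorem ramificationIdx_maximalRealSubfield_le_two (L : Type) [Field L] [NumberField L] [IsCMField L] (W : HeightOneSpectrum (𝓞 L)) :
    W.asIdeal.ramificationIdx (𝓞 ↥(maximalRealSubfield L)) ≤ 2 := by
  haveI : IsGaloisGroup (L ≃ₐ[↥(maximalRealSubfield L)] L) (𝓞 ↥(maximalRealSubfield L)) (𝓞 L) :=
    IsGaloisGroup.of_isFractionRing _ _ _ (↥(maximalRealSubfield L)) L
  haveI := W.isPrime
  set q := W.under (𝓞 ↥(maximalRealSubfield L)) with hq
  haveI : W.asIdeal.LiesOver q.asIdeal := ⟨rfl⟩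
  have hcard : Nat.card (L ≃ₐ[↥(maximalRealSubfield L)] L) = 2 := by
    rw [IsGalois.card_aut_eq_finrank, (IsCMField.isQuadraticExtension L).finrank_eq_two]
  have h := Ideal.ncard_primesOver_mul_ramificationIdxIn_mul_inertiaDegIn q.asIdeal (𝓞 L) (L ≃ₐ[↥(maximalRealSubfield L)] L)
  rw [hcard] at h
  have hne : (q.asIdeal.primesOver (𝓞 L)).ncard ≠ 0 := by
    intro h0; rw [h0, zero_mul] at h; exact absurd h (by norm_num)
  have hdvd : q.asIdeal.ramificationIdxIn (𝓞 L) ∣ 2 := by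
    refine ⟨(q.asIdeal.primesOver (𝓞 L)).ncard * q.asIdeal.inertiaDegIn (𝓞 L), ?_⟩
    rw [← h]; ring
  rw [← Ideal.ramificationIdxIn_eq_ramificationIdx q.asIdeal W.asIdeal (L ≃ₐ[↥(maximalRealSubfield L)] L)]
  exact Nat.le_of_dvd two_pos hdvd

include hκ hK in
/-- **(RAM) for `X_{n+1} ⊆ X_{n+2}`**: if a prime `w` of `X_{n+1}` is ramified over `X_{n+1}⁺` (so lies over an odd prime factor `q` of `d_K`), then for every prime `W` of
`X_{n+2}` above `w`: `e(W ∣ w) = 1` and `e(W ∣ W ∩ X_{n+2}⁺) = e(w ∣ w ∩ X_{n+1}⁺)` (`= 2`): `X_{n+2}⁺ ≅ ℚ_{n+2}` is unramified at `q`, `e ≤ 2` in `X/X⁺`, and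
`e(W ∣ q) = e(W ∣ w)·e(w ∣ v)·e(v ∣ q)`. [cite: Ferrero1980AJM, §2] [cite: Washington1997, §13.1] [cite: NeukirchANT1999, Ch. I §9 Prop. (9.6)] -/
theorem ram_fieldRange_sup_layer_pair (hd : Odd (NumberField.discr K).natAbs) (n : ℕ) :
    haveI : NumberField ↥(j.fieldRange ⊔ κ.layer (n + 1)) := numberField_fieldRange_sup_layer κ K j (n + 1)
    haveI : NumberField ↥(j.fieldRange ⊔ κ.layer (n + 2)) := numberField_fieldRange_sup_layer κ K j (n + 2)
    letI : Algebra ↥(j.fieldRange ⊔ κ.layer (n + 1)) ↥(j.fieldRange ⊔ κ.layer (n + 2)) :=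
      (IntermediateField.inclusion (sup_le_sup_left (κ.layer_mono (by omega)) _)).toRingHom.toAlgebra
    ∀ [IsCMField ↥(j.fieldRange ⊔ κ.layer (n + 1))] [IsCMField ↥(j.fieldRange ⊔ κ.layer (n + 2))],
    ∀ w : HeightOneSpectrum (𝓞 ↥(j.fieldRange ⊔ κ.layer (n + 1))),
      w.asIdeal.ramificationIdx (𝓞 ↥(maximalRealSubfield ↥(j.fieldRange ⊔ κ.layer (n + 1)))) ≠ 1 →
      ∀ W : HeightOneSpectrum (𝓞 ↥(j.fieldRange ⊔ κ.layer (n + 2))), W.under (𝓞 ↥(j.fieldRange ⊔ κ.layer (n + 1))) = w →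
        W.asIdeal.ramificationIdx (𝓞 ↥(j.fieldRange ⊔ κ.layer (n + 1))) = 1 ∧
          W.asIdeal.ramificationIdx (𝓞 ↥(maximalRealSubfield ↥(j.fieldRange ⊔ κ.layer (n + 2)))) =
            w.asIdeal.ramificationIdx (𝓞 ↥(maximalRealSubfield ↥(j.fieldRange ⊔ κ.layer (n + 1)))) := by
  intro _instM _instL w hw W hW
  set M := ↥(j.fieldRange ⊔ κ.layer (n + 1))
  set L := ↥(j.fieldRange ⊔ κ.layer (n + 2))
  haveI : NumberField M := numberField_fieldRange_sup_layer κ K j (n + 1)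
  haveI : NumberField L := numberField_fieldRange_sup_layer κ K j (n + 2)
  have hML : j.fieldRange ⊔ κ.layer (n + 1) ≤ j.fieldRange ⊔ κ.layer (n + 2) := sup_le_sup_left (κ.layer_mono (by omega)) _
  letI : Algebra M L := (IntermediateField.inclusion hML).toRingHom.toAlgebra
  obtain ⟨_, _, hrestM⟩ := isCMField_fieldRange_sup_layer hκ K hK j (n + 1)
  obtain ⟨_, _, hrestL⟩ := isCMField_fieldRange_sup_layer hκ K hK j (n + 2)
  obtain ⟨-, -, hdiscM, hgenM⟩ := hrestM
  obtain ⟨-, -, hdiscL, -⟩ := hrestL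
  -- `K`-algebra structure on `M` through `j`
  let eK : K →+* M := (j : K →+* AlgebraicClosure ℚ).codRestrict (j.fieldRange ⊔ κ.layer (n + 1)) fun x =>
    (le_sup_left : j.fieldRange ≤ j.fieldRange ⊔ κ.layer (n + 1)) (j.mem_fieldRange.mpr ⟨x, rfl⟩)
  letI algK : Algebra K M := eK.toAlgebra
  haveI : Module.Free ℚ K := Module.Free.of_divisionRing _ _
  haveI : Algebra.IsQuadraticExtension ℚ K := { finrank_eq_two' := hK.1 }
  haveI : IsGalois ℚ K := Algebra.IsQuadraticExtension.isGalois ℚ K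
  -- the prime `v` of `M⁺` under `w` is ramified in `M`, hence over an odd prime factor `q` of `d_K`
  set v := w.under (𝓞 ↥(maximalRealSubfield M)) with hv
  haveI := w.isPrime
  haveI := W.isPrime
  haveI : w.asIdeal.LiesOver v.asIdeal := ⟨rfl⟩
  have hvram : v.asIdeal.ramificationIdxIn (𝓞 M) ≠ 1 := by
    rwa [Ideal.ramificationIdxIn_eq_ramificationIdx v.asIdeal w.asIdeal (M ≃ₐ[↥(maximalRealSubfield M)] M)]
  obtain ⟨q, hq, hqd, hvq⟩ := exists_dvd_discr_of_ramificationIdxIn_ne_one M K hgenM v hvram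
  haveI := hvq
  have hq2 : q ≠ 2 := by
    rintro rfl
    exact (Nat.not_even_iff_odd.mpr hd) (even_iff_two_dvd.mpr (Int.natAbs_dvd_natAbs.mpr hqd |>.trans (by simp)))
  -- primes: `W ∩ L⁺ = 𝔮`, `W ∩ M = w`, `w ∩ M⁺ = v`, all over `q`
  set 𝔮 := W.under (𝓞 ↥(maximalRealSubfield L)) with h𝔮
  haveI : W.asIdeal.LiesOver 𝔮.asIdeal := ⟨rfl⟩
  haveI : W.asIdeal.LiesOver w.asIdeal := ⟨by rw [← hW]; rfl⟩
  haveI hwq : w.asIdeal.LiesOver (Ideal.span {(q : ℤ)}) := Ideal.LiesOver.trans w.asIdeal v.asIdeal _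
  haveI hWq : W.asIdeal.LiesOver (Ideal.span {(q : ℤ)}) := Ideal.LiesOver.trans W.asIdeal w.asIdeal _
  haveI h𝔮q : 𝔮.asIdeal.LiesOver (Ideal.span {(q : ℤ)}) := Ideal.LiesOver.tower_bot W.asIdeal 𝔮.asIdeal _
  -- `e(𝔮 ∣ q) = 1`
  have hq' : Prime (q : ℤ) := Nat.prime_iff_prime_int.mp hq
  have he𝔮 : 𝔮.asIdeal.ramificationIdx ℤ = 1 := by
    have hunr := (NumberField.not_dvd_discr_iff_isUnramifiedIn ↥(maximalRealSubfield L) (𝓞 ↥(maximalRealSubfield L)) hq').mp (hdiscL q hq hq2)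
    haveI : (Ideal.span {(q : ℤ)}).IsMaximal := by
      haveI : Fact q.Prime := ⟨hq⟩; exact Int.ideal_span_isMaximal_of_prime q
    haveI := 𝔮.isPrime
    exact (Algebra.isUnramifiedIn_iff_forall_ramificationIdx_eq_one.mp hunr) 𝔮.asIdeal h𝔮q
  -- the towers
  have h1 : W.asIdeal.ramificationIdx ℤ = 𝔮.asIdeal.ramificationIdx ℤ * W.asIdeal.ramificationIdx (𝓞 ↥(maximalRealSubfield L)) :=
    Ideal.ramificationIdx_tower (R := ℤ) (S := 𝓞 ↥(maximalRealSubfield L)) (T := 𝓞 L) (q := 𝔮.asIdeal) (r := W.asIdeal)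
  have h2 : W.asIdeal.ramificationIdx ℤ = w.asIdeal.ramificationIdx ℤ * W.asIdeal.ramificationIdx (𝓞 M) :=
    Ideal.ramificationIdx_tower (R := ℤ) (S := 𝓞 M) (T := 𝓞 L) (q := w.asIdeal) (r := W.asIdeal)
  have h3 : w.asIdeal.ramificationIdx ℤ = v.asIdeal.ramificationIdx ℤ * w.asIdeal.ramificationIdx (𝓞 ↥(maximalRealSubfield M)) :=
    Ideal.ramificationIdx_tower (R := ℤ) (S := 𝓞 ↥(maximalRealSubfield M)) (T := 𝓞 M) (q := v.asIdeal) (r := w.asIdeal)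
  have hle2 := ramificationIdx_maximalRealSubfield_le_two L W
  have hposW : 0 < W.asIdeal.ramificationIdx (𝓞 M) := Ideal.ramificationIdx_pos _ _
  have hposv : 0 < v.asIdeal.ramificationIdx ℤ := by haveI := v.isPrime; exact Ideal.ramificationIdx_pos _ _
  have hposw : 0 < w.asIdeal.ramificationIdx (𝓞 ↥(maximalRealSubfield M)) := Ideal.ramificationIdx_pos _ _
  rw [he𝔮, one_mul] at h1
  -- arithmetic: `a = e(W|L⁺) ≤ 2`, `a = x·b·c` with `b = e(w|M⁺) ≥ 2`, `c = e(W|w) ≥ 1`, `x ≥ 1`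
  set a := W.asIdeal.ramificationIdx (𝓞 ↥(maximalRealSubfield L))
  set b := w.asIdeal.ramificationIdx (𝓞 ↥(maximalRealSubfield M))
  set c := W.asIdeal.ramificationIdx (𝓞 M)
  set x := v.asIdeal.ramificationIdx ℤ
  have hb2 : 2 ≤ b := by omega
  have habc : a = x * b * c := by rw [← h1, h2, h3]
  have hc1 : c = 1 := by
    by_contra hc
    have hc2 : 2 ≤ c := by omega
    have : 4 ≤ a := by
      rw [habc]
      calc 4 = 1 * 2 * 2 := by norm_num
        _ ≤ x * b * c := Nat.mul_le_mul (Nat.mul_le_mul hposv hb2) hc2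
    omega
  refine ⟨hc1, ?_⟩
  rw [hc1, mul_one] at habc
  have : b ≤ a := by rw [habc]; exact Nat.le_mul_of_pos_left b hposv
  omega

end Ram

/-! ## §4 (NPI) from «no new roots of unity» and Hasse–Weber squares; (T); the injectivity for the pair -/

section Pair

variable {κ : ZpExtension ℚ 2} (hκ : κ.IsCyclotomic) (K : Type) [Field K] [NumberField K] (hK : IsImaginaryQuadratic K)
  (j : K →ₐ[ℚ] AlgebraicClosure ℚ)

include hκ hK in
/-- **(NPI) for `X_m = j(K)·ℚ_m`**: if the roots of unity of `X_m` lie in `j(K)` and `−1` is not a square in `K`, then no unit `ε` of `X_m` has `ε̄ = −ε`.  For such an `ε`,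
`εε̄ = −ε²` is a totally positive unit of `X_m⁺`, hence a square `s²` (Weber–Hasse on `ℚ_m ≅ X_m⁺`); then `(ε/s)² = −1`, a fourth root of unity outside `j(K)`.
[cite: Lemmermeyer1995, §2 Proposition 1 c)] [cite: Washington1997, Cor. 10.5 and §13.1] -/
theorem complexConj_unit_ne_neg_fieldRange_sup_layer (m : ℕ) (hi : ∀ k : K, k ^ 2 ≠ -1)
    (hW : ∀ x : ↥(j.fieldRange ⊔ κ.layer m), (∃ k : ℕ, 0 < k ∧ x ^ k = 1) → (x : AlgebraicClosure ℚ) ∈ j.fieldRange) :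
    haveI : NumberField ↥(j.fieldRange ⊔ κ.layer m) := numberField_fieldRange_sup_layer κ K j m
    ∀ [IsCMField ↥(j.fieldRange ⊔ κ.layer m)], ∀ u : (𝓞 ↥(j.fieldRange ⊔ κ.layer m))ˣ,
      complexConj ↥(j.fieldRange ⊔ κ.layer m) ((u : 𝓞 ↥(j.fieldRange ⊔ κ.layer m)) : ↥(j.fieldRange ⊔ κ.layer m)) ≠
        -((u : 𝓞 ↥(j.fieldRange ⊔ κ.layer m)) : ↥(j.fieldRange ⊔ κ.layer m)) := by
  intro _inst u hneg
  set X := ↥(j.fieldRange ⊔ κ.layer m)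
  haveI : NumberField X := numberField_fieldRange_sup_layer κ K j m
  obtain ⟨_, _, hrest⟩ := isCMField_fieldRange_sup_layer hκ K hK j m
  obtain ⟨-, hsq, -, -⟩ := hrest
  obtain ⟨η, hη⟩ := Lemmermeyer1995.exists_algebraMap_eq_mul_unitsComplexConj X u
  have hpos := Lemmermeyer1995.embedding_pos_of_algebraMap_eq_mul_unitsComplexConj X hη
  obtain ⟨s, hs⟩ := hsq η hpos
  set e : X := ((u : 𝓞 X) : X) with he
  have he0 : e ≠ 0 := by rw [he]; exact_mod_cast (Units.ne_zero u)
  set s' : X := ((algebraMap (𝓞 ↥(maximalRealSubfield X)) (𝓞 X) (s : 𝓞 ↥(maximalRealSubfield X)) : 𝓞 X) : X) with hs'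
  -- `e ē = s'²` and `ē = −e`
  have hval : e * complexConj X e = s' * s' := by
    have h1 := congrArg (fun t : 𝓞 X => (t : X)) hη
    simp only [Units.val_mul] at h1
    push_cast at h1
    change ((algebraMap (𝓞 ↥(maximalRealSubfield X)) (𝓞 X) (η : 𝓞 ↥(maximalRealSubfield X)) : 𝓞 X) : X) = e * complexConj X e at h1
    rw [← h1, hs, Units.val_mul, map_mul]
    push_cast
    rfl
  rw [hneg, mul_neg] at hval
  have hs0 : s' ≠ 0 := by
    intro h0; rw [h0, mul_zero, neg_eq_zero] at hval; exact (mul_ne_zero he0 he0) hval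
  -- `y = e/s'` has `y² = −1`, `y⁴ = 1`
  have hy2 : (e / s') ^ 2 = -1 := by
    rw [div_pow, div_eq_iff (pow_ne_zero 2 hs0)]
    linear_combination -hval
  have hy4 : (e / s') ^ 4 = 1 := by
    rw [show (4 : ℕ) = 2 * 2 from rfl, pow_mul, hy2]; norm_num
  obtain ⟨k, hk⟩ := j.mem_fieldRange.mp (hW (e / s') ⟨4, by norm_num, hy4⟩)
  apply hi k
  have h2 := congrArg (algebraMap X (AlgebraicClosure ℚ)) hy2
  rw [map_pow, map_neg, map_one] at h2
  change ((e / s' : X) : AlgebraicClosure ℚ) ^ 2 = -1 at h2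
  rw [← hk, ← map_pow] at h2
  have : j (k ^ 2 + 1) = j 0 := by rw [map_add, h2, map_one, map_zero]; ring
  have := j.injective this
  linear_combination this

include hκ hK in
/-- ★ **No capitulation for the pair `X_{n+1} ⊆ X_{n+2}` modulo (W)**: `K` imaginary quadratic with odd `d_K` and `−1 ∉ K²`, `κ` cyclotomic; if every root of unity of
`X_{n+2} = j(K)·ℚ_{n+2}` lies in `j(K)` (W), then **`Cl(X_{n+1}) → Cl(X_{n+2})` is injective** (`NumberFields/CMFieldQuadraticLayerNoCapitulation` with (T) ⟸ (W),
(NPI) ⟸ (W), (ODD) and (RAM) from §2–§3). [cite: Ferrero1980AJM, §3] [cite: Kida1979Tohoku, Thm. 1 (proof)] [cite: Washington1997, Prop. 13.26] -/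
theorem classGroupExtend_injective_fieldRange_sup_layer (hd : Odd (NumberField.discr K).natAbs) (hi : ∀ k : K, k ^ 2 ≠ -1) (n : ℕ)
    (hW : ∀ x : ↥(j.fieldRange ⊔ κ.layer (n + 2)), (∃ k : ℕ, 0 < k ∧ x ^ k = 1) → (x : AlgebraicClosure ℚ) ∈ j.fieldRange) :
    haveI : NumberField ↥(j.fieldRange ⊔ κ.layer (n + 1)) := numberField_fieldRange_sup_layer κ K j (n + 1)
    haveI : NumberField ↥(j.fieldRange ⊔ κ.layer (n + 2)) := numberField_fieldRange_sup_layer κ K j (n + 2)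
    letI : Algebra ↥(j.fieldRange ⊔ κ.layer (n + 1)) ↥(j.fieldRange ⊔ κ.layer (n + 2)) :=
      (IntermediateField.inclusion (sup_le_sup_left (κ.layer_mono (by omega)) _)).toRingHom.toAlgebra
    Function.Injective (classGroupExtend ↥(j.fieldRange ⊔ κ.layer (n + 1)) ↥(j.fieldRange ⊔ κ.layer (n + 2))) := by
  set M := ↥(j.fieldRange ⊔ κ.layer (n + 1))
  set L := ↥(j.fieldRange ⊔ κ.layer (n + 2))
  haveI : NumberField M := numberField_fieldRange_sup_layer κ K j (n + 1)
  haveI : NumberField L := numberField_fieldRange_sup_layer κ K j (n + 2)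
  have hML : j.fieldRange ⊔ κ.layer (n + 1) ≤ j.fieldRange ⊔ κ.layer (n + 2) := sup_le_sup_left (κ.layer_mono (by omega)) _
  letI : Algebra M L := (IntermediateField.inclusion hML).toRingHom.toAlgebra
  haveI : IsScalarTower ℚ M L := IsScalarTower.of_algebraMap_eq fun _ => rfl
  obtain ⟨hCMM, hdegM, hrestM⟩ := isCMField_fieldRange_sup_layer hκ K hK j (n + 1)
  obtain ⟨hCML, hdegL, hrestL⟩ := isCMField_fieldRange_sup_layer hκ K hK j (n + 2)
  haveI := hCMM
  haveI := hCML
  obtain ⟨hodd, -, -, -⟩ := hrestM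
  have h2 : Module.finrank M L = 2 := by
    have h : 2 ^ (n + 1) * 2 * Module.finrank M L = 2 ^ (n + 2) * 2 := by
      rw [← hdegM, ← hdegL]; exact Module.finrank_mul_finrank ℚ M L
    have h' : 2 ^ (n + 2) * 2 = 2 ^ (n + 1) * 2 * 2 := by ring
    have hpos : 0 < 2 ^ (n + 1) * 2 := by positivity
    exact Nat.eq_of_mul_eq_mul_left hpos (h.trans h')
  refine classGroupExtend_injective_of_cmLayer M L h2 hodd ?_ ?_ ?_
  · -- (T) from (W): a root of unity of `L` lies in `j(K) ⊆ M`
    intro σ x k hk hxk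
    have hxK := hW x ⟨k, hk, hxk⟩
    have hxM : (x : AlgebraicClosure ℚ) ∈ j.fieldRange ⊔ κ.layer (n + 1) := (le_sup_left : j.fieldRange ≤ _) hxK
    have : x = algebraMap M L ⟨(x : AlgebraicClosure ℚ), hxM⟩ := Subtype.ext rfl
    rw [this, AlgEquiv.commutes]
  · exact complexConj_unit_ne_neg_fieldRange_sup_layer hκ K hK j (n + 2) hi hW
  · exact ram_fieldRange_sup_layer_pair hκ K hK j hd n

end Pair

end Literature.NumberTheory.IwasawaTheory

end
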